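import Summits.QuantumFields.YangMills.Theorems.ColdStartUniversalityLatticeLangevinBakryEmeryHessian
import Summits.QuantumFields.YangMills.Theorems.ColdStartUniversalityLatticeLangevinGeneratorFrameForm
import Summits.QuantumFields.YangMills.Theorems.ColdStartUniversalityLatticeLangevinCarreDuChampDictionary
import Summits.QuantumFields.YangMills.Theorems.ColdStartUniversalityLatticeLangevinWilsonHolleyStroock
import HarnessLib

/-!
# Route `ColdStartUniversality` (fixed-cut-off package): EXPLICIT SECOND-ORDER BOUNDS FOR THE PLAQUETTE FUNCTION — two-sided frame Hessian
# `|ΣΣ x_n x_m W_nW_mψ̂| ≤ 24|β'|Σx²`, frame Laplacian `|Σ_n W_n²ψ̂| ≤ 192|β'|·#E`, `|𝓛₀ψ̂| ≤ 96|β'|·#E`, and the EXPLICIT lower bound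
# `V̂ ≥ −48|β'|·#E` for the ground-state potential of the SZZ dynamics (towards an explicit cold-start density / entropy budget)

Helper file (seat `ym-line-csu-p1`, g27; `--supports stmt-QuantumFields-24809`).  The tree's density bound for the law of the SU(2) SZZ
dynamics after a positive time (`map_le_smul_haar_of_le`, hence the KL budget `wilson_klDiv_map_le_log` of g26 and every cold-start mixing
statement) carries a constant that is only known to EXIST (`exists_abs_groundStatePotential_le`, `exists_groundState_bounds` by compactness).
This file makes the ground-state ingredients explicit in the volume:
* ★ `wilson_hessForm_abs_le` — for every configuration and every coefficient vector `x`: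
  `|Σ_(n,m) x_n x_m · D(Dψ̂[s_m])(y)[s_n y]| ≤ 24|β'|·Σ_n x_n²` (two-sided, free-coefficient form of g25's `wilson_hessBound`; venture
  `abs_hessianForm_le_four_d`);
* ★ `wilson_frameLaplacian_abs_le` — `|Σ_n D(Dψ̂[s_n])(y)[s_n y]| ≤ 24|β'|·#(E × NoiseIdx) = 192|β'|·#E`;
* ★★ `wilson_generator_zero_psiHat_abs_le` — the `β' = 0` (pure Casimir/Laplace) coordinate generator of `ψ̂_b` is bounded:
  `|𝓛₀ ψ̂_b (V)| ≤ 96|b|·#E` (`𝓛₀ = ½Σ_n W_n²`, `generator_eq_half_frameGen` at coupling `0`);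
* ★★ `groundStatePotential_ge_explicit` — the ground-state potential `V̂ = ½𝓛₀ψ̂ + ⅛Γ₀(ψ̂)` satisfies `V̂ ≥ −48|β'|·#E` on `SU(2)^E`
  (exactly the hypothesis `hK` of `groundState_subsolution`, with `K = 48|β'|·#E`; `Γ₀ ≥ 0`);
* `abs_psiHat_coords_le` — `|ψ̂_b(coords V)| ≤ 2|b|·#𝒫` (`0 ≤ S_W ≤ 4#𝒫`).
(#E = #𝒫 = 3L³ on `(ℤ/L)³`.)  THEOREMS ONLY, no definition, no sorry.  HONEST FRAMING: fixed-cut-off plumbing (explicit constants for the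
RECORD rung's burn-in); nothing K-uniform; no crux, rung or summit statement is proved; the Yang–Mills mass gap is NOT proved.
-/

set_option autoImplicit false

noncomputable section

namespace Summit.QuantumFields.YangMills.Theorems.ColdStartUniversality

open MeasureTheory Matrix Complex Finset
open scoped ComplexConjugate BigOperators Matrix
open Literature.MathematicalPhysics.QuantumFieldTheory
open Literature.MathematicalPhysics.QuantumLattice (fundamentalRep fundamentalLatticeRep continuous_fundamentalRep fundamentalRep_apply
  fundamentalLatticeRep_N)
open Summit.Ventures.YMGap.HessianSharp (perturb wilsonRe plaqRe plaqReDeriv hessianForm tangentNormSq frobSq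
  abs_hessianForm_le_four_d)

variable {L : ℕ} [NeZero L]

/-! ## §1. The two-sided frame Hessian bound with free coefficients -/

/-- ★ **Two-sided frame Hessian bound for the plaquette function, free coefficients.**  For every configuration `V`, coupling `β'`
and coefficient vector `x` on `E × NoiseIdx`: `|Σ_(n,m) x_n x_m D(z ↦ Dψ̂(z)[s_m z])(y)[s_n y]| ≤ 24|β'| Σ_n x_n²`, `y = coords V`
(the left sum is `β'·hessianForm(Q, A)` with `A_e = √2 Σ_ν x_(e,ν) 𝐩E_ν`, `|hessianForm| ≤ 12 Σ_e‖A_e‖² ≤ 24 Σ x²`).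
[cite: ShenZhuZhu2022, §4 Lemma 4.1] -/
theorem wilson_hessForm_abs_le (L : ℕ) [NeZero L] (β' : ℝ) (V : (GaugeConfig 3 L (Matrix.specialUnitaryGroup (Fin 2) ℂ))) (x : Edge 3 L × NoiseIdx (fundamentalLatticeRep 2).N → ℝ) :
    |∑ n : Edge 3 L × NoiseIdx (fundamentalLatticeRep 2).N, ∑ m : Edge 3 L × NoiseIdx (fundamentalLatticeRep 2).N, x n * x m * fderiv ℝ (fun z : (Edge 3 L × Fin (fundamentalLatticeRep 2).N × Fin (fundamentalLatticeRep 2).N × Bool → ℝ) => fderiv ℝ (fun y : (Edge 3 L × Fin (fundamentalLatticeRep 2).N × Fin (fundamentalLatticeRep 2).N × Bool → ℝ) => β' * ∑ p : Plaquette 3 L, (rootedLoop (fun (ee : Edge 3 L) (i j : Fin (fundamentalLatticeRep 2).N) => ((y (ee, i, j, false) : ℝ) : ℂ) + ((y (ee, i, j, true) : ℝ) : ℂ) * Complex.I) (p.1, p.2.1.1) p.2.1.2 false).trace.re) z (fun q : Edge 3 L × Fin (fundamentalLatticeRep 2).N × Fin (fundamentalLatticeRep 2).N × Bool => if m.1 =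 q.1 then (fun z : ℂ => if q.2.2.2 then z.im else z.re) (((Real.sqrt 2 : ℂ) • ((fundamentalLatticeRep 2).lieProj (noiseDir m.2) * (fun (ee : Edge 3 L) => Matrix.of fun (i j : Fin (fundamentalLatticeRep 2).N) => ((z (ee, i, j, false) : ℝ) : ℂ) + ((z (ee, i, j, true) : ℝ) : ℂ) * Complex.I) q.1)) q.2.1 q.2.2.1) else 0)) ((fun (V : GaugeConfig 3 L (Matrix.specialUnitaryGroup (Fin 2) ℂ)) (q : Edge 3 L × Fin (fundamentalLatticeRep 2).N × Fin (fundamentalLatticeRep 2).N × Bool) => (fun z : ℂ => if q.2.2.2 then z.im else z.re) ((fundamentalRep (Fin 2) (V q.1) : Matrix (Fin 2) (Fin 2) ℂ) q.2.1 q.2.2.1)) V) (fun q : Edge 3 L × Fin (fundamentalLatticeRep 2).N × Fin (fundamentalLatticeRep 2).N × Bool => if n.1 = q.1 then (fun z : ℂ => if q.2.2.2 then z.im else z.re) (((Real.sqrt 2 : ℂ) • ((fundamentalLatticeRep 2).lieProj (noiseDir n.2) * (fun (ee : Edge 3 L) => Matrix.of fun (i j : Fin (fundamentalLatticeRep 2).N)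 => (((fun (V : GaugeConfig 3 L (Matrix.specialUnitaryGroup (Fin 2) ℂ)) (q : Edge 3 L × Fin (fundamentalLatticeRep 2).N × Fin (fundamentalLatticeRep 2).N × Bool) => (fun z : ℂ => if q.2.2.2 then z.im else z.re) ((fundamentalRep (Fin 2) (V q.1) : Matrix (Fin 2) (Fin 2) ℂ) q.2.1 q.2.2.1)) V (ee, i, j, false) : ℝ) : ℂ) + (((fun (V : GaugeConfig 3 L (Matrix.specialUnitaryGroup (Fin 2) ℂ)) (q : Edge 3 L × Fin (fundamentalLatticeRep 2).N × Fin (fundamentalLatticeRep 2).N × Bool) => (fun z : ℂ => if q.2.2.2 then z.im else z.re) ((fundamentalRep (Fin 2) (V q.1) : Matrix (Fin 2) (Fin 2) ℂ) q.2.1 q.2.2.1)) V (ee, i, j, true) : ℝ) : ℂ) * Complex.I) q.1)) q.2.1 q.2.2.1) else 0)|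
      ≤ 24 * |β'| * ∑ n : Edge 3 L × NoiseIdx (fundamentalLatticeRep 2).N, x n ^ 2 := by
  classical
  obtain ⟨s, c, hs, -, -, -, -⟩ := exists_noiseFrame L
  -- abbreviations
  set P : NoiseIdx (fundamentalLatticeRep 2).N → Matrix (Fin (fundamentalLatticeRep 2).N) (Fin (fundamentalLatticeRep 2).N) ℂ := fun ν => (fundamentalLatticeRep 2).lieProj (noiseDir ν) with hP
  set reb : (Edge 3 L × Fin (fundamentalLatticeRep 2).N × Fin (fundamentalLatticeRep 2).N × Bool → ℝ) → (Edge 3 L → Matrix (Fin (fundamentalLatticeRep 2).N) (Fin (fundamentalLatticeRep 2).N) ℂ) := fun z => (fun (ee : Edge 3 L) => Matrix.of fun (i j : Fin (fundamentalLatticeRep 2).N) => ((z (ee, i, j, false) : ℝ) : ℂ) + ((z (ee, i, j, true) : ℝ) : ℂ) * Complex.I) with hreb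
  set flat : (Edge 3 L → Matrix (Fin (fundamentalLatticeRep 2).N) (Fin (fundamentalLatticeRep 2).N) ℂ) → (Edge 3 L × Fin (fundamentalLatticeRep 2).N × Fin (fundamentalLatticeRep 2).N × Bool → ℝ) := fun M => (fun q : Edge 3 L × Fin (fundamentalLatticeRep 2).N × Fin (fundamentalLatticeRep 2).N × Bool => (fun z : ℂ => if q.2.2.2 then z.im else z.re) (M q.1 q.2.1 q.2.2.1)) with hflat
  set σ : (Edge 3 L × NoiseIdx (fundamentalLatticeRep 2).N) → (Edge 3 L × Fin (fundamentalLatticeRep 2).N × Fin (fundamentalLatticeRep 2).N × Bool → ℝ) → (Edge 3 L × Fin (fundamentalLatticeRep 2).N × Fin (fundamentalLatticeRep 2).N × Bool → ℝ) := fun n z => (fun q : Edge 3 L × Fin (fundamentalLatticeRep 2).N × Fin (fundamentalLatticeRep 2).N × Bool => if n.1 = q.1 then (fun z : ℂ => if q.2.2.2 then z.im else z.re) (((Real.sqrt 2 : ℂ) • ((fundamentalLatticeRep 2).lieProj (noiseDir n.2) * (fun (ee : Edge 3 L) => Matrix.of fun (i j : Fin (fundamentalLatticeRep 2).N) => ((z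 (ee, i, j, false) : ℝ) : ℂ) + ((z (ee, i, j, true) : ℝ) : ℂ) * Complex.I) q.1)) q.2.1 q.2.2.1) else 0) with hσ
  set ψ : (Edge 3 L × Fin (fundamentalLatticeRep 2).N × Fin (fundamentalLatticeRep 2).N × Bool → ℝ) → ℝ := (fun y : (Edge 3 L × Fin (fundamentalLatticeRep 2).N × Fin (fundamentalLatticeRep 2).N × Bool → ℝ) => β' * ∑ p : Plaquette 3 L, (rootedLoop (fun (ee : Edge 3 L) (i j : Fin (fundamentalLatticeRep 2).N) => ((y (ee, i, j, false) : ℝ) : ℂ) + ((y (ee, i, j, true) : ℝ) : ℂ) * Complex.I) (p.1, p.2.1.1) p.2.1.2 false).trace.re) with hψ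
  set y : (Edge 3 L × Fin (fundamentalLatticeRep 2).N × Fin (fundamentalLatticeRep 2).N × Bool → ℝ) := (fun (V : GaugeConfig 3 L (Matrix.specialUnitaryGroup (Fin 2) ℂ)) (q : Edge 3 L × Fin (fundamentalLatticeRep 2).N × Fin (fundamentalLatticeRep 2).N × Bool) => (fun z : ℂ => if q.2.2.2 then z.im else z.re) ((fundamentalRep (Fin 2) (V q.1) : Matrix (Fin 2) (Fin 2) ℂ) q.2.1 q.2.2.1)) V with hy
  have hsσ : ∀ n z, s n z = σ n z := fun n z => hs n z
  -- `rebuild` facts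
  have r_smul : ∀ (a : ℝ) (v : (Edge 3 L × Fin (fundamentalLatticeRep 2).N × Fin (fundamentalLatticeRep 2).N × Bool → ℝ)), reb (a • v) = (a : ℂ) • reb v := fun a v => rebuild_smul a v
  have r_sum : ∀ f : (Edge 3 L × NoiseIdx (fundamentalLatticeRep 2).N) → (Edge 3 L × Fin (fundamentalLatticeRep 2).N × Fin (fundamentalLatticeRep 2).N × Bool → ℝ), reb (∑ k, f k) = ∑ k, reb (f k) :=
    fun f => rebuild_sum Finset.univ f
  have r_inj : ∀ v w : (Edge 3 L × Fin (fundamentalLatticeRep 2).N × Fin (fundamentalLatticeRep 2).N × Bool → ℝ), reb v = reb w → v = w := fun v w h => eq_of_rebuild_eq h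
  have r_flat : ∀ M : (Edge 3 L → Matrix (Fin (fundamentalLatticeRep 2).N) (Fin (fundamentalLatticeRep 2).N) ℂ), reb (flat M) = M := fun M => rebuild_flat_of M
  have r_σ : ∀ n z, reb (σ n z) = fun e => if n.1 = e then (Real.sqrt 2 : ℂ) • (P n.2 * reb z e) else 0 :=
    fun n z => rebuild_noise n z
  have flat_reb : ∀ v : (Edge 3 L × Fin (fundamentalLatticeRep 2).N × Fin (fundamentalLatticeRep 2).N × Bool → ℝ), flat (reb v) = v := fun v => r_inj _ _ (r_flat _)
  -- the combined field `S = Σ_n x_n s_n`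
  set S : (Edge 3 L × Fin (fundamentalLatticeRep 2).N × Fin (fundamentalLatticeRep 2).N × Bool → ℝ) →L[ℝ] (Edge 3 L × Fin (fundamentalLatticeRep 2).N × Fin (fundamentalLatticeRep 2).N × Bool → ℝ) := ∑ n, x n • s n with hSdef
  have hS_apply : ∀ z, S z = ∑ n, x n • s n z := fun z => by
    rw [hSdef, _root_.sum_apply]
    simp only [FunLike.coe_smul, Pi.smul_apply]
  -- the matrices `Z_e = Σ_ν x_(e,ν) 𝐩E_ν ∈ 𝔤`, `A_e = √2 Z_e`, `Q_e = V_e`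
  set Z : (Edge 3 L → Matrix (Fin (fundamentalLatticeRep 2).N) (Fin (fundamentalLatticeRep 2).N) ℂ) := fun e => ∑ ν, x (e, ν) • P ν with hZ
  set A : (Edge 3 L → Matrix (Fin (fundamentalLatticeRep 2).N) (Fin (fundamentalLatticeRep 2).N) ℂ) := fun e => (Real.sqrt 2 : ℂ) • Z e with hA
  set Q : (Edge 3 L → Matrix (Fin (fundamentalLatticeRep 2).N) (Fin (fundamentalLatticeRep 2).N) ℂ) := fun e => Matrix.of fun i j : Fin (fundamentalLatticeRep 2).N =>
    (fundamentalRep (Fin 2) (V e) : Matrix (Fin 2) (Fin 2) ℂ) i j with hQ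
  have hrebY : reb y = Q := rebuild_coords_of V
  have hyQ : flat Q = y := by rw [← hrebY, flat_reb]
  have hZmem : ∀ e, Z e ∈ (fundamentalLatticeRep 2).lieAlg := fun e =>
    Submodule.sum_mem _ fun ν _ => Submodule.smul_mem _ _ ((fundamentalLatticeRep 2).lieProj_mem _)
  have hZskew : ∀ e, (Z e)ᴴ = -Z e := fun e => by
    rw [← Matrix.star_eq_conjTranspose]
    exact (fundamentalLatticeRep 2).star_eq_neg_of_mem_lieAlg (hZmem e)
  have hAskew : ∀ e, (A e)ᴴ = -A e := fun e => by
    simp only [hA, Matrix.conjTranspose_smul, RCLike.star_def, Complex.conj_ofReal, hZskew, smul_neg]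
  have hQU : ∀ e, Q e ∈ Matrix.unitaryGroup (Fin (fundamentalLatticeRep 2).N) ℂ := fun e =>
    Matrix.specialUnitaryGroup_le_unitaryGroup (V e).2
  have cx : ∀ (a : ℝ) (W : Matrix (Fin (fundamentalLatticeRep 2).N) (Fin (fundamentalLatticeRep 2).N) ℂ), a • W = (a : ℂ) • W := fun a W => by
    ext i j
    simp only [Matrix.smul_apply, Complex.real_smul, smul_eq_mul]
  -- (F1) `rebuild (S z) = (A_e · rebuild(z)_e)_e`
  have hrebS : ∀ z, reb (S z) = fun e => A e * reb z e := by
    intro z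
    rw [hS_apply, r_sum]
    simp_rw [r_smul, hsσ, r_σ]
    funext e
    rw [Finset.sum_apply]
    have hsplit : ∑ n : Edge 3 L × NoiseIdx (fundamentalLatticeRep 2).N,
        ((x n : ℂ) • (fun e' : Edge 3 L => if n.1 = e' then (Real.sqrt 2 : ℂ) • (P n.2 * reb z e') else (0 : Matrix (Fin (fundamentalLatticeRep 2).N) (Fin (fundamentalLatticeRep 2).N) ℂ))) e
        = ∑ e' : Edge 3 L, ∑ ν : NoiseIdx (fundamentalLatticeRep 2).N,
          ((x (e', ν) : ℂ) • (fun e'' : Edge 3 L => if (e', ν).1 = e'' then (Real.sqrt 2 : ℂ) • (P (e', ν).2 * reb z e'') else (0 : Matrix (Fin (fundamentalLatticeRep 2).N) (Fin (fundamentalLatticeRep 2).N) ℂ))) e :=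
      Fintype.sum_prod_type _
    rw [hsplit, Finset.sum_eq_single e (fun e' _ hne => Finset.sum_eq_zero fun ν _ => by
      simp only [Pi.smul_apply, if_neg hne, smul_zero]) (fun h => absurd (Finset.mem_univ e) h)]
    simp only [Pi.smul_apply, if_true, hA, hZ, Finset.smul_sum, Finset.sum_mul, Matrix.smul_mul]
    refine Finset.sum_congr rfl fun ν _ => ?_
    rw [cx, smul_comm]
  have hSflat : ∀ z, S z = flat (fun e => A e * reb z e) := fun z =>
    r_inj _ _ ((hrebS z).trans (r_flat _).symm)
  -- `ψ̂(flat M) = β' · wilsonRe M`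
  have hψW : ∀ M : (Edge 3 L → Matrix (Fin (fundamentalLatticeRep 2).N) (Fin (fundamentalLatticeRep 2).N) ℂ), ψ (flat M) = β' * wilsonRe M := by
    intro M
    have h1 : ψ (flat M) = β' * ∑ p : Plaquette 3 L, (rootedLoop (reb (flat M)) (p.1, p.2.1.1) p.2.1.2 false).trace.re := rfl
    rw [h1, r_flat]
    simp only [wilsonRe, plaqRe, rootedLoop]
  have hψC : ContDiff ℝ 2 ψ := contDiff_psiHat (d := 3) (L := L) (N := (fundamentalLatticeRep 2).N) (n := 2) β'
  -- (F2) the second frame derivative is `β' · hessianForm Q A`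
  have hkey : fderiv ℝ (fun z => fderiv ℝ ψ z (S z)) y (S y) = β' * hessianForm Q A := by
    have h : fderiv ℝ (fun z => fderiv ℝ ψ z (S z)) (flat Q) (S (flat Q)) = β' * hessianForm Q A :=
      fderiv_frameDeriv_eq_mul_hessianForm Q A hAskew β' ψ hψC hψW S hSflat
    rw [hyQ] at h
    exact h
  -- (F3) bilinear expansion
  have hexp : fderiv ℝ (fun z => fderiv ℝ ψ z (S z)) y (S y)
      = ∑ n, ∑ m, x n * x m * fderiv ℝ (fun z => fderiv ℝ ψ z (s m z)) y (s n y) := by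
    have hGsum : (fun z => fderiv ℝ ψ z (S z)) = fun z => ∑ m, x m * fderiv ℝ ψ z (s m z) := by
      funext z
      rw [hS_apply, map_sum]
      exact Finset.sum_congr rfl fun m _ => by rw [map_smul, smul_eq_mul]
    rw [hGsum, fderiv_sum_mul_apply Finset.univ x (fun m _ => differentiableAt_frameDeriv hψC (s m) y) (S y)]
    simp_rw [hS_apply, map_sum, map_smul, smul_eq_mul, Finset.mul_sum]
    rw [Finset.sum_comm]
    refine Finset.sum_congr rfl fun n _ => Finset.sum_congr rfl fun m _ => ?_
    ring
  have hE : ∑ n, ∑ m, x n * x m * fderiv ℝ (fun z => fderiv ℝ ψ z (s m z)) y (s n y) = β' * hessianForm Q A := by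
    rw [← hexp]; exact hkey
  -- (F4) the venture's bound and `Σ_e ‖A_e‖² ≤ 2 Σ x²`
  have hH : |hessianForm Q A| ≤ 12 * tangentNormSq A := by
    have h := abs_hessianForm_le_four_d Q A hQU
    push_cast at h
    linarith
  have hT : tangentNormSq A ≤ 2 * ∑ n, x n ^ 2 := by
    have hTe : tangentNormSq A = ∑ e, hsForm (fundamentalLatticeRep 2).N (A e) (A e) := rfl
    have hAe : ∀ e, hsForm (fundamentalLatticeRep 2).N (A e) (A e) = 2 * hsForm (fundamentalLatticeRep 2).N (Z e) (Z e) := fun e => by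
      show hsForm (fundamentalLatticeRep 2).N ((Real.sqrt 2 : ℂ) • Z e) ((Real.sqrt 2 : ℂ) • Z e) = _
      rw [hsForm_coe_smul_left, hsForm_coe_smul_right, ← mul_assoc, Real.mul_self_sqrt zero_le_two]
    have hZe : ∀ e, hsForm (fundamentalLatticeRep 2).N (Z e) (Z e) ≤ ∑ ν, x (e, ν) ^ 2 := fun e => by
      have hZp : Z e = (fundamentalLatticeRep 2).lieProj (∑ ν, x (e, ν) • noiseDir ν) := by
        show ∑ ν, x (e, ν) • P ν = _
        rw [map_sum]
        simp only [map_smul, hP]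
      rw [hZp, ← hsForm_sum_smul_noiseDir_self]
      exact hsForm_lieProj_self_le (fundamentalLatticeRep 2) _
    have hsum : ∑ e, hsForm (fundamentalLatticeRep 2).N (Z e) (Z e) ≤ ∑ e : Edge 3 L, ∑ ν : NoiseIdx (fundamentalLatticeRep 2).N, x (e, ν) ^ 2 :=
      Finset.sum_le_sum fun e _ => hZe e
    have hprod : ∑ n, x n ^ 2 = ∑ e : Edge 3 L, ∑ ν : NoiseIdx (fundamentalLatticeRep 2).N, x (e, ν) ^ 2 :=
      Fintype.sum_prod_type (fun n : Edge 3 L × NoiseIdx (fundamentalLatticeRep 2).N => x n ^ 2)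
    rw [hTe, hprod, Finset.sum_congr rfl fun e _ => hAe e, ← Finset.mul_sum]
    linarith
  have main : |∑ n, ∑ m, x n * x m * fderiv ℝ (fun z => fderiv ℝ ψ z (s m z)) y (s n y)| ≤ 24 * |β'| * ∑ n, x n ^ 2 := by
    rw [hE, abs_mul]
    calc |β'| * |hessianForm Q A| ≤ |β'| * (12 * tangentNormSq A) := mul_le_mul_of_nonneg_left hH (abs_nonneg _)
      _ ≤ |β'| * (12 * (2 * ∑ n, x n ^ 2)) :=
          mul_le_mul_of_nonneg_left (mul_le_mul_of_nonneg_left hT (by norm_num)) (abs_nonneg _)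
      _ = 24 * |β'| * ∑ n, x n ^ 2 := by ring
  -- back to the statement's vocabulary
  have hsz : ∀ k : Edge 3 L × NoiseIdx (fundamentalLatticeRep 2).N, (fun z : (Edge 3 L × Fin (fundamentalLatticeRep 2).N × Fin (fundamentalLatticeRep 2).N × Bool → ℝ) => fderiv ℝ ψ z (s k z)) = fun z => fderiv ℝ ψ z (σ k z) :=
    fun k => funext fun z => congrArg (fderiv ℝ ψ z) (hs k z)
  have hsV : ∀ k : Edge 3 L × NoiseIdx (fundamentalLatticeRep 2).N, s k y = σ k y := fun k => hs k y
  simp only [hsz, hsV] at main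
  exact main

/-! ## §2. The frame Laplacian and the `β' = 0` generator of the plaquette function -/

/-- ★ **Frame Laplacian bound**: `|Σ_n D(z ↦ Dψ̂(z)[s_n z])(y)[s_n y]| ≤ 24|β'|·#(E × NoiseIdx)` at every configuration
(diagonal case of `wilson_hessForm_abs_le`, summed). [cite: ShenZhuZhu2022, §4 Lemma 4.1] -/
theorem wilson_frameLaplacian_abs_le (L : ℕ) [NeZero L] (β' : ℝ) (V : (GaugeConfig 3 L (Matrix.specialUnitaryGroup (Fin 2) ℂ))) :
    |∑ n : Edge 3 L × NoiseIdx (fundamentalLatticeRep 2).N, fderiv ℝ (fun z : (Edge 3 L × Fin (fundamentalLatticeRep 2).N × Fin (fundamentalLatticeRep 2).N × Bool → ℝ) => fderiv ℝ (fun y : (Edge 3 L × Fin (fundamentalLatticeRep 2).N × Fin (fundamentalLatticeRep 2).N × Bool → ℝ) => β' * ∑ p : Plaquette 3 L, (rootedLoop (fun (ee : Edge 3 L) (i j : Fin (fundamentalLatticeRep 2).N) => ((y (ee, i, j, false) : ℝ) : ℂ) + ((y (ee, i, j, true) : ℝ) : ℂ) * Complex.I) (p.1, p.2.1.1) p.2.1.2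 false).trace.re) z (fun q : Edge 3 L × Fin (fundamentalLatticeRep 2).N × Fin (fundamentalLatticeRep 2).N × Bool => if n.1 = q.1 then (fun z : ℂ => if q.2.2.2 then z.im else z.re) (((Real.sqrt 2 : ℂ) • ((fundamentalLatticeRep 2).lieProj (noiseDir n.2) * (fun (ee : Edge 3 L) => Matrix.of fun (i j : Fin (fundamentalLatticeRep 2).N) => ((z (ee, i, j, false) : ℝ) : ℂ) + ((z (ee, i, j, true) : ℝ) : ℂ) * Complex.I) q.1)) q.2.1 q.2.2.1) else 0)) ((fun (V : GaugeConfig 3 L (Matrix.specialUnitaryGroup (Fin 2) ℂ)) (q : Edge 3 L × Fin (fundamentalLatticeRep 2).N × Fin (fundamentalLatticeRep 2).N × Bool) => (fun z : ℂ => if q.2.2.2 then z.im else z.re) ((fundamentalRep (Fin 2) (V q.1) : Matrix (Fin 2) (Fin 2) ℂ) q.2.1 q.2.2.1)) V) (fun q : Edge 3 L × Fin (fundamentalLatticeRep 2).N × Fin (fundamentalLatticeRep 2).N × Bool => if n.1 = q.1 then (fun z : ℂ => if q.2.2.2 then z.im else z.re) (((Real.sqrt 2 : ℂ) • ((fundamentalLatticeRep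 2).lieProj (noiseDir n.2) * (fun (ee : Edge 3 L) => Matrix.of fun (i j : Fin (fundamentalLatticeRep 2).N) => (((fun (V : GaugeConfig 3 L (Matrix.specialUnitaryGroup (Fin 2) ℂ)) (q : Edge 3 L × Fin (fundamentalLatticeRep 2).N × Fin (fundamentalLatticeRep 2).N × Bool) => (fun z : ℂ => if q.2.2.2 then z.im else z.re) ((fundamentalRep (Fin 2) (V q.1) : Matrix (Fin 2) (Fin 2) ℂ) q.2.1 q.2.2.1)) V (ee, i, j, false) : ℝ) : ℂ) + (((fun (V : GaugeConfig 3 L (Matrix.specialUnitaryGroup (Fin 2) ℂ)) (q : Edge 3 L × Fin (fundamentalLatticeRep 2).N × Fin (fundamentalLatticeRep 2).N × Bool) => (fun z : ℂ => if q.2.2.2 then z.im else z.re) ((fundamentalRep (Fin 2) (V q.1) : Matrix (Fin 2) (Fin 2) ℂ) q.2.1 q.2.2.1)) V (ee, i, j, true) : ℝ) : ℂ) * Complex.I) q.1)) q.2.1 q.2.2.1) else 0)|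
      ≤ 24 * |β'| * Fintype.card (Edge 3 L × NoiseIdx (fundamentalLatticeRep 2).N) := by
  classical
  set T : (Edge 3 L × NoiseIdx (fundamentalLatticeRep 2).N) → (Edge 3 L × NoiseIdx (fundamentalLatticeRep 2).N) → ℝ := fun n m => fderiv ℝ (fun z : (Edge 3 L × Fin (fundamentalLatticeRep 2).N × Fin (fundamentalLatticeRep 2).N × Bool → ℝ) => fderiv ℝ (fun y : (Edge 3 L × Fin (fundamentalLatticeRep 2).N × Fin (fundamentalLatticeRep 2).N × Bool → ℝ) => β' * ∑ p : Plaquette 3 L, (rootedLoop (fun (ee : Edge 3 L) (i j : Fin (fundamentalLatticeRep 2).N) => ((y (ee, i, j, false) : ℝ) : ℂ) + ((y (ee, i, j, true) : ℝ) : ℂ) * Complex.I) (p.1, p.2.1.1) p.2.1.2 false).trace.re) z (fun q : Edge 3 L × Fin (fundamentalLatticeRep 2).N × Fin (fundamentalLatticeRep 2).N × Bool => if m.1 = q.1 then (fun z : ℂ => if q.2.2.2 then z.im else z.re) (((Real.sqrt 2 : ℂ) • ((fundamentalLatticeRep 2).lieProj (noiseDir m.2) * (fun (ee : Edge 3 L)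 => Matrix.of fun (i j : Fin (fundamentalLatticeRep 2).N) => ((z (ee, i, j, false) : ℝ) : ℂ) + ((z (ee, i, j, true) : ℝ) : ℂ) * Complex.I) q.1)) q.2.1 q.2.2.1) else 0)) ((fun (V : GaugeConfig 3 L (Matrix.specialUnitaryGroup (Fin 2) ℂ)) (q : Edge 3 L × Fin (fundamentalLatticeRep 2).N × Fin (fundamentalLatticeRep 2).N × Bool) => (fun z : ℂ => if q.2.2.2 then z.im else z.re) ((fundamentalRep (Fin 2) (V q.1) : Matrix (Fin 2) (Fin 2) ℂ) q.2.1 q.2.2.1)) V) (fun q : Edge 3 L × Fin (fundamentalLatticeRep 2).N × Fin (fundamentalLatticeRep 2).N × Bool => if n.1 = q.1 then (fun z : ℂ => if q.2.2.2 then z.im else z.re) (((Real.sqrt 2 : ℂ) • ((fundamentalLatticeRep 2).lieProj (noiseDir n.2) * (fun (ee : Edge 3 L) => Matrix.of fun (i j : Fin (fundamentalLatticeRep 2).N) => (((fun (V : GaugeConfig 3 L (Matrix.specialUnitaryGroup (Fin 2) ℂ)) (q : Edge 3 L × Fin (fundamentalLatticeRep 2).N × Fin (fundamentalLatticeRep 2).N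 × Bool) => (fun z : ℂ => if q.2.2.2 then z.im else z.re) ((fundamentalRep (Fin 2) (V q.1) : Matrix (Fin 2) (Fin 2) ℂ) q.2.1 q.2.2.1)) V (ee, i, j, false) : ℝ) : ℂ) + (((fun (V : GaugeConfig 3 L (Matrix.specialUnitaryGroup (Fin 2) ℂ)) (q : Edge 3 L × Fin (fundamentalLatticeRep 2).N × Fin (fundamentalLatticeRep 2).N × Bool) => (fun z : ℂ => if q.2.2.2 then z.im else z.re) ((fundamentalRep (Fin 2) (V q.1) : Matrix (Fin 2) (Fin 2) ℂ) q.2.1 q.2.2.1)) V (ee, i, j, true) : ℝ) : ℂ) * Complex.I) q.1)) q.2.1 q.2.2.1) else 0) with hT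
  have hdiag : ∀ n : Edge 3 L × NoiseIdx (fundamentalLatticeRep 2).N, |T n n| ≤ 24 * |β'| := by
    intro n
    have h := wilson_hessForm_abs_le L β' V (fun k => if k = n then (1 : ℝ) else 0)
    have hsum : ∑ n' : Edge 3 L × NoiseIdx (fundamentalLatticeRep 2).N, ∑ m : Edge 3 L × NoiseIdx (fundamentalLatticeRep 2).N, (if n' = n then (1 : ℝ) else 0) * (if m = n then (1 : ℝ) else 0) * T n' m = T n n := by
      have h1 : ∀ a : Edge 3 L × NoiseIdx (fundamentalLatticeRep 2).N, ∑ m : Edge 3 L × NoiseIdx (fundamentalLatticeRep 2).N, (if a = n then (1 : ℝ) else 0) * (if m = n then (1 : ℝ) else 0) * T a m =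
          (if a = n then (1 : ℝ) else 0) * T a n := by
        intro a
        rw [Finset.sum_eq_single n]
        · rw [if_pos rfl, mul_one]
        · intro m _ hm; rw [if_neg hm]; ring
        · intro h; exact absurd (Finset.mem_univ n) h
      rw [Finset.sum_congr rfl fun a _ => h1 a, Finset.sum_eq_single n]
      · rw [if_pos rfl, one_mul]
      · intro a _ ha; rw [if_neg ha]; ring
      · intro h; exact absurd (Finset.mem_univ n) h
    have hsq : ∑ n' : Edge 3 L × NoiseIdx (fundamentalLatticeRep 2).N, (if n' = n then (1 : ℝ) else 0) ^ 2 = 1 := by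
      rw [Finset.sum_eq_single n]
      · rw [if_pos rfl]; norm_num
      · intro a _ ha; rw [if_neg ha]; norm_num
      · intro h; exact absurd (Finset.mem_univ n) h
    have h' : |∑ n' : Edge 3 L × NoiseIdx (fundamentalLatticeRep 2).N, ∑ m : Edge 3 L × NoiseIdx (fundamentalLatticeRep 2).N, (if n' = n then (1 : ℝ) else 0) * (if m = n then (1 : ℝ) else 0) * T n' m|
        ≤ 24 * |β'| * ∑ n' : Edge 3 L × NoiseIdx (fundamentalLatticeRep 2).N, (if n' = n then (1 : ℝ) else 0) ^ 2 := h
    rw [hsum, hsq, mul_one] at h'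
    exact h'
  have h1 : |∑ n : Edge 3 L × NoiseIdx (fundamentalLatticeRep 2).N, T n n| ≤ ∑ n : Edge 3 L × NoiseIdx (fundamentalLatticeRep 2).N, |T n n| := Finset.abs_sum_le_sum_abs _ _
  have h2 : ∑ n : Edge 3 L × NoiseIdx (fundamentalLatticeRep 2).N, |T n n| ≤ ∑ _n : Edge 3 L × NoiseIdx (fundamentalLatticeRep 2).N, 24 * |β'| := Finset.sum_le_sum fun n _ => hdiag n
  rw [Finset.sum_const, Finset.card_univ, nsmul_eq_mul] at h2
  have h3 : |∑ n : Edge 3 L × NoiseIdx (fundamentalLatticeRep 2).N, T n n| ≤ 24 * |β'| * Fintype.card (Edge 3 L × NoiseIdx (fundamentalLatticeRep 2).N) := by linarith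
  simpa only [hT] using h3

/-- `#(E × NoiseIdx 2) = 8·#E`. [folklore] -/
theorem card_edge_noiseIdx (L : ℕ) [NeZero L] : Fintype.card (Edge 3 L × NoiseIdx (fundamentalLatticeRep 2).N) = 8 * Fintype.card (Edge 3 L) := by
  rw [Fintype.card_prod]
  have h : Fintype.card (NoiseIdx (fundamentalLatticeRep 2).N) = 8 := by
    rw [fundamentalLatticeRep_N]
    rfl
  rw [h, mul_comm]

/-- ★★ **The `β' = 0` coordinate generator of the plaquette function is `O(#E)`**: for every configuration `V` and coefficient `b`,
`|𝓛₀ ψ̂_b (V)| ≤ 96|b|·#E`, where `𝓛₀` is the coordinate generator of the SZZ dynamics at coupling `0` (Brownian motion on `SU(2)^E`: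
Casimir drift + `½σσᵀ∂²`), `= ½ Σ_n W_n² ψ̂_b` by `generator_eq_half_frameGen`. [cite: ShenZhuZhu2022, §3 Lemma 3.1] -/
theorem wilson_generator_zero_psiHat_abs_le (L : ℕ) [NeZero L] (b : ℝ) (V : (GaugeConfig 3 L (Matrix.specialUnitaryGroup (Fin 2) ℂ))) :
    let coords : GaugeConfig 3 L (Matrix.specialUnitaryGroup (Fin 2) ℂ) → (Edge 3 L × Fin 2 × Fin 2 × Bool → ℝ) :=
      fun V q => (fun z : ℂ => if q.2.2.2 then z.im else z.re)
        ((fundamentalRep (Fin 2) (V q.1) : Matrix (Fin 2) (Fin 2) ℂ) q.2.1 q.2.2.1)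
    let gen : ((Edge 3 L × Fin 2 × Fin 2 × Bool → ℝ) → ℝ) → GaugeConfig 3 L (Matrix.specialUnitaryGroup (Fin 2) ℂ) → ℝ :=
      fun h V =>
      (∑ i : Edge 3 L × Fin 2 × Fin 2 × Bool, fderiv ℝ h (coords V) (Pi.single i 1) *
          (fun z : ℂ => if i.2.2.2 then z.im else z.re)
            ((latticeLangevinDynamics (fundamentalLatticeRep 2) 0).drift
              (matrixConfig (fundamentalRep (Fin 2)) V) i.1 i.2.1 i.2.2.1) +
      1 / 2 * ∑ i : Edge 3 L × Fin 2 × Fin 2 × Bool, ∑ j : Edge 3 L × Fin 2 × Fin 2 × Bool,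
        fderiv ℝ (fun z => fderiv ℝ h z (Pi.single i 1)) (coords V) (Pi.single j 1) *
          ∑ n : Edge 3 L × NoiseIdx 2,
            (if n.1 = i.1 then (fun z : ℂ => if i.2.2.2 then z.im else z.re)
              ((latticeLangevinDynamics (fundamentalLatticeRep 2) 0).noise
                (matrixConfig (fundamentalRep (Fin 2)) V) i.1 n.2 i.2.1 i.2.2.1) else 0) *
            (if n.1 = j.1 then (fun z : ℂ => if j.2.2.2 then z.im else z.re)
              ((latticeLangevinDynamics (fundamentalLatticeRep 2) 0).noise
                (matrixConfig (fundamentalRep (Fin 2)) V) j.1 n.2 j.2.1 j.2.2.1) else 0))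
    |gen (fun y : (Edge 3 L × Fin 2 × Fin 2 × Bool → ℝ) => b * ∑ p : Plaquette 3 L, (rootedLoop (fun (ee : Edge 3 L) (i j : Fin 2) => ((y (ee, i, j, false) : ℝ) : ℂ) + ((y (ee, i, j, true) : ℝ) : ℂ) * Complex.I) (p.1, p.2.1.1) p.2.1.2 false).trace.re) V| ≤ 96 * |b| * Fintype.card (Edge 3 L) := by
  intro coords gen
  classical
  obtain ⟨s, c, hs, -, -, -, hCas⟩ := exists_noiseFrame L
  have hfC : ContDiff ℝ 2 (fun y : (Edge 3 L × Fin 2 × Fin 2 × Bool → ℝ) => b * ∑ p : Plaquette 3 L, (rootedLoop (fun (ee : Edge 3 L) (i j : Fin 2) => ((y (ee, i, j, false) : ℝ) : ℂ) + ((y (ee, i, j, true) : ℝ) : ℂ) * Complex.I) (p.1, p.2.1.1) p.2.1.2 false).trace.re) := contDiff_psiHat (d := 3) (L := L) (N := 2) (n := 2) b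
  have hfr := generator_eq_half_frameGen L 0 s hs hCas (fun y : (Edge 3 L × Fin 2 × Fin 2 × Bool → ℝ) => b * ∑ p : Plaquette 3 L, (rootedLoop (fun (ee : Edge 3 L) (i j : Fin 2) => ((y (ee, i, j, false) : ℝ) : ℂ) + ((y (ee, i, j, true) : ℝ) : ℂ) * Complex.I) (p.1, p.2.1.1) p.2.1.2 false).trace.re) hfC V
  -- the coupling-0 plaquette function vanishes identically
  have h0 : (fun y : (Edge 3 L × Fin (fundamentalLatticeRep 2).N × Fin (fundamentalLatticeRep 2).N × Bool → ℝ) => (0 : ℝ) * ∑ p : Plaquette 3 L, (rootedLoop (fun (ee : Edge 3 L) (i j : Fin (fundamentalLatticeRep 2).N) => ((y (ee, i, j, false) : ℝ) : ℂ) + ((y (ee, i, j, true) : ℝ) : ℂ) * Complex.I) (p.1, p.2.1.1) p.2.1.2 false).trace.re) = fun _ => 0 :=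
    funext fun y => zero_mul _
  have hgen : gen (fun y : (Edge 3 L × Fin 2 × Fin 2 × Bool → ℝ) => b * ∑ p : Plaquette 3 L, (rootedLoop (fun (ee : Edge 3 L) (i j : Fin 2) => ((y (ee, i, j, false) : ℝ) : ℂ) + ((y (ee, i, j, true) : ℝ) : ℂ) * Complex.I) (p.1, p.2.1.1) p.2.1.2 false).trace.re) V = 1 / 2 * ∑ n : Edge 3 L × NoiseIdx (fundamentalLatticeRep 2).N, fderiv ℝ (fun w => fderiv ℝ (fun y : (Edge 3 L × Fin 2 × Fin 2 × Bool → ℝ) => b * ∑ p : Plaquette 3 L, (rootedLoop (fun (ee : Edge 3 L) (i j : Fin 2) => ((y (ee, i, j, false) : ℝ) : ℂ) + ((y (ee, i, j, true) : ℝ) : ℂ) * Complex.I) (p.1, p.2.1.1) p.2.1.2 false).trace.re) w (s n w)) (coords V) (s n (coords V)) := by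
    refine hfr.trans ?_
    congr 1
    refine Finset.sum_congr rfl fun n _ => ?_
    rw [h0, fderiv_const_apply, _root_.zero_apply, zero_mul, add_zero]
  -- the frame Laplacian bound, read through `s = σ`
  have hL := wilson_frameLaplacian_abs_le L b V
  rw [card_edge_noiseIdx] at hL
  have hsz : ∀ k : Edge 3 L × NoiseIdx (fundamentalLatticeRep 2).N, (fun w : (Edge 3 L × Fin 2 × Fin 2 × Bool → ℝ) => fderiv ℝ (fun y : (Edge 3 L × Fin 2 × Fin 2 × Bool → ℝ) => b * ∑ p : Plaquette 3 L, (rootedLoop (fun (ee : Edge 3 L) (i j : Fin 2) => ((y (ee, i, j, false) : ℝ) : ℂ) + ((y (ee, i, j, true) : ℝ) : ℂ) * Complex.I) (p.1, p.2.1.1) p.2.1.2 false).trace.re) w (s k w)) = fun w => fderiv ℝ (fun y : (Edge 3 L × Fin 2 × Fin 2 × Bool → ℝ) => b * ∑ p : Plaquette 3 L, (rootedLoop (fun (ee : Edge 3 L) (i j : Fin 2) => ((y (ee, i, j, false) : ℝ) : ℂ) + ((y (ee, i, j, true) : ℝ) : ℂ) * Complex.I) (p.1, p.2.1.1) p.2.1.2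 false).trace.re) w (fun q : Edge 3 L × Fin (fundamentalLatticeRep 2).N × Fin (fundamentalLatticeRep 2).N × Bool => if k.1 = q.1 then (fun z : ℂ => if q.2.2.2 then z.im else z.re) (((Real.sqrt 2 : ℂ) • ((fundamentalLatticeRep 2).lieProj (noiseDir k.2) * (fun (ee : Edge 3 L) => Matrix.of fun (i j : Fin (fundamentalLatticeRep 2).N) => ((w (ee, i, j, false) : ℝ) : ℂ) + ((w (ee, i, j, true) : ℝ) : ℂ) * Complex.I) q.1)) q.2.1 q.2.2.1) else 0) :=
    fun k => funext fun w => congrArg (fderiv ℝ (fun y : (Edge 3 L × Fin 2 × Fin 2 × Bool → ℝ) => b * ∑ p : Plaquette 3 L, (rootedLoop (fun (ee : Edge 3 L) (i j : Fin 2) => ((y (ee, i, j, false) : ℝ) : ℂ) + ((y (ee, i, j, true) : ℝ) : ℂ) * Complex.I) (p.1, p.2.1.1) p.2.1.2 false).trace.re) w) (hs k w)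
  have hsV : ∀ k : Edge 3 L × NoiseIdx (fundamentalLatticeRep 2).N, s k (coords V) = (fun q : Edge 3 L × Fin (fundamentalLatticeRep 2).N × Fin (fundamentalLatticeRep 2).N × Bool => if k.1 = q.1 then (fun z : ℂ => if q.2.2.2 then z.im else z.re) (((Real.sqrt 2 : ℂ) • ((fundamentalLatticeRep 2).lieProj (noiseDir k.2) * (fun (ee : Edge 3 L) => Matrix.of fun (i j : Fin (fundamentalLatticeRep 2).N) => (((coords V) (ee, i, j, false) : ℝ) : ℂ) + (((coords V) (ee, i, j, true) : ℝ) : ℂ) * Complex.I) q.1)) q.2.1 q.2.2.1) else 0) := fun k => hs k (coords V)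
  have hterm : ∀ k : Edge 3 L × NoiseIdx (fundamentalLatticeRep 2).N, fderiv ℝ (fun w : (Edge 3 L × Fin 2 × Fin 2 × Bool → ℝ) => fderiv ℝ (fun y : (Edge 3 L × Fin 2 × Fin 2 × Bool → ℝ) => b * ∑ p : Plaquette 3 L, (rootedLoop (fun (ee : Edge 3 L) (i j : Fin 2) => ((y (ee, i, j, false) : ℝ) : ℂ) + ((y (ee, i, j, true) : ℝ) : ℂ) * Complex.I) (p.1, p.2.1.1) p.2.1.2 false).trace.re) w (s k w)) (coords V) (s k (coords V)) =
      fderiv ℝ (fun w : (Edge 3 L × Fin 2 × Fin 2 × Bool → ℝ) => fderiv ℝ (fun y : (Edge 3 L × Fin 2 × Fin 2 × Bool → ℝ) => b * ∑ p : Plaquette 3 L, (rootedLoop (fun (ee : Edge 3 L) (i j : Fin 2) => ((y (ee, i, j, false) : ℝ) : ℂ) + ((y (ee, i, j, true) : ℝ) : ℂ) * Complex.I) (p.1, p.2.1.1) p.2.1.2 false).trace.re) w (fun q : Edge 3 L × Fin (fundamentalLatticeRep 2).N × Fin (fundamentalLatticeRep 2).N × Bool => if k.1 = q.1 then (fun z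 : ℂ => if q.2.2.2 then z.im else z.re) (((Real.sqrt 2 : ℂ) • ((fundamentalLatticeRep 2).lieProj (noiseDir k.2) * (fun (ee : Edge 3 L) => Matrix.of fun (i j : Fin (fundamentalLatticeRep 2).N) => ((w (ee, i, j, false) : ℝ) : ℂ) + ((w (ee, i, j, true) : ℝ) : ℂ) * Complex.I) q.1)) q.2.1 q.2.2.1) else 0)) (coords V) (fun q : Edge 3 L × Fin (fundamentalLatticeRep 2).N × Fin (fundamentalLatticeRep 2).N × Bool => if k.1 = q.1 then (fun z : ℂ => if q.2.2.2 then z.im else z.re) (((Real.sqrt 2 : ℂ) • ((fundamentalLatticeRep 2).lieProj (noiseDir k.2) * (fun (ee : Edge 3 L) => Matrix.of fun (i j : Fin (fundamentalLatticeRep 2).N) => (((coords V) (ee, i, j, false) : ℝ) : ℂ) + (((coords V) (ee, i, j, true) : ℝ) : ℂ) * Complex.I) q.1)) q.2.1 q.2.2.1) else 0) := fun k => by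
    rw [hsz k, hsV k]
  have hL' : |∑ n : Edge 3 L × NoiseIdx (fundamentalLatticeRep 2).N, fderiv ℝ (fun w => fderiv ℝ (fun y : (Edge 3 L × Fin 2 × Fin 2 × Bool → ℝ) => b * ∑ p : Plaquette 3 L, (rootedLoop (fun (ee : Edge 3 L) (i j : Fin 2) => ((y (ee, i, j, false) : ℝ) : ℂ) + ((y (ee, i, j, true) : ℝ) : ℂ) * Complex.I) (p.1, p.2.1.1) p.2.1.2 false).trace.re) w (s n w)) (coords V) (s n (coords V))| ≤ 24 * |b| * (8 * Fintype.card (Edge 3 L)) := by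
    rw [Finset.sum_congr rfl fun k _ => hterm k]
    have hL2 : |∑ n : Edge 3 L × NoiseIdx (fundamentalLatticeRep 2).N, fderiv ℝ (fun w : (Edge 3 L × Fin 2 × Fin 2 × Bool → ℝ) => fderiv ℝ (fun y : (Edge 3 L × Fin 2 × Fin 2 × Bool → ℝ) => b * ∑ p : Plaquette 3 L, (rootedLoop (fun (ee : Edge 3 L) (i j : Fin 2) => ((y (ee, i, j, false) : ℝ) : ℂ) + ((y (ee, i, j, true) : ℝ) : ℂ) * Complex.I) (p.1, p.2.1.1) p.2.1.2 false).trace.re) w (fun q : Edge 3 L × Fin (fundamentalLatticeRep 2).N × Fin (fundamentalLatticeRep 2).N × Bool => if n.1 = q.1 then (fun z : ℂ => if q.2.2.2 then z.im else z.re) (((Real.sqrt 2 : ℂ) • ((fundamentalLatticeRep 2).lieProj (noiseDir n.2) * (fun (ee : Edge 3 L) => Matrix.of fun (i j : Fin (fundamentalLatticeRep 2).N) => ((w (ee, i, j, false) : ℝ) : ℂ) + ((w (ee, i, j, true) : ℝ) : ℂ) * Complex.I) q.1)) q.2.1 q.2.2.1) else 0)) (coords V) (fun q : Edge 3 L ×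 Fin (fundamentalLatticeRep 2).N × Fin (fundamentalLatticeRep 2).N × Bool => if n.1 = q.1 then (fun z : ℂ => if q.2.2.2 then z.im else z.re) (((Real.sqrt 2 : ℂ) • ((fundamentalLatticeRep 2).lieProj (noiseDir n.2) * (fun (ee : Edge 3 L) => Matrix.of fun (i j : Fin (fundamentalLatticeRep 2).N) => (((coords V) (ee, i, j, false) : ℝ) : ℂ) + (((coords V) (ee, i, j, true) : ℝ) : ℂ) * Complex.I) q.1)) q.2.1 q.2.2.1) else 0)| ≤ 24 * |b| * ((8 * Fintype.card (Edge 3 L) : ℕ) : ℝ) := hL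
    push_cast at hL2
    exact hL2
  rw [hgen, abs_mul, abs_of_pos (by norm_num : (0 : ℝ) < 1 / 2)]
  linarith

/-! ## §3. The explicit lower bound of the ground-state potential and the bound of `ψ̂` -/

/-- ★★ **Explicit lower bound of the ground-state potential** (the hypothesis `hK` of `groundState_subsolution` with
`K = 48|β'|·#E`): `V̂ = ½𝓛₀ψ̂ + ⅛Γ₀(ψ̂) ≥ −48|β'|·#E` on `SU(2)^E`, since `|𝓛₀ψ̂| ≤ 96|β'|·#E` and `Γ₀(ψ̂) = Σ_n (Dψ̂[σ_n])² ≥ 0`.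
[cite: ShenZhuZhu2022, §3 Lemma 3.1] -/
theorem groundStatePotential_ge_explicit (L : ℕ) [NeZero L] (β' : ℝ) :
    ∀ V : GaugeConfig 3 L (Matrix.specialUnitaryGroup (Fin 2) ℂ),
      let x : (Edge 3 L × Fin 2 × Fin 2 × Bool) → ℝ := fun q =>
        (fun z : ℂ => if q.2.2.2 then z.im else z.re)
          ((fundamentalRep (Fin 2) (V q.1) : Matrix (Fin 2) (Fin 2) ℂ) q.2.1 q.2.2.1)
      let b₀ : (Edge 3 L × Fin 2 × Fin 2 × Bool) → ℝ := fun q =>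
        (fun z : ℂ => if q.2.2.2 then z.im else z.re) ((latticeLangevinDynamics (fundamentalLatticeRep 2) 0).drift
          (matrixConfig (fundamentalRep (Fin 2)) V) q.1 q.2.1 q.2.2.1)
      let σ : (Edge 3 L × Fin 2 × Fin 2 × Bool) → (Edge 3 L × NoiseIdx 2) → ℝ := fun q k =>
        if k.1 = q.1 then (fun z : ℂ => if q.2.2.2 then z.im else z.re)
          ((latticeLangevinDynamics (fundamentalLatticeRep 2) 0).noise
            (matrixConfig (fundamentalRep (Fin 2)) V) q.1 k.2 q.2.1 q.2.2.1) else 0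
      let ψ : ((Edge 3 L × Fin 2 × Fin 2 × Bool) → ℝ) → ℝ := fun y =>
        β' * ∑ p : Plaquette 3 L, (rootedLoop (fun (e : Edge 3 L) (i j : Fin 2) =>
          ((y (e, i, j, false) : ℝ) : ℂ) + ((y (e, i, j, true) : ℝ) : ℂ) * Complex.I) (p.1, p.2.1.1) p.2.1.2 false).trace.re
      1 / 2 * (∑ i, fderiv ℝ ψ x (Pi.single i 1) * b₀ i +
          1 / 2 * ∑ i, ∑ j, fderiv ℝ (fun z => fderiv ℝ ψ z (Pi.single i 1)) x (Pi.single j 1) * ∑ n, σ i n * σ j n) +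
        1 / 8 * ∑ i, ∑ j, fderiv ℝ ψ x (Pi.single i 1) * fderiv ℝ ψ x (Pi.single j 1) * ∑ n, σ i n * σ j n ≥ -(48 * |β'| * Fintype.card (Edge 3 L)) := by
  intro V
  dsimp only
  have hgen : |(∑ i : Edge 3 L × Fin 2 × Fin 2 × Bool, fderiv ℝ (fun y : (Edge 3 L × Fin 2 × Fin 2 × Bool → ℝ) => β' * ∑ p : Plaquette 3 L, (rootedLoop (fun (ee : Edge 3 L) (i j : Fin 2) => ((y (ee, i, j, false) : ℝ) : ℂ) + ((y (ee, i, j, true) : ℝ) : ℂ) * Complex.I) (p.1, p.2.1.1) p.2.1.2 false).trace.re) ((fun (V : GaugeConfig 3 L (Matrix.specialUnitaryGroup (Fin 2) ℂ)) (q : Edge 3 L × Fin 2 × Fin 2 × Bool) => (fun z : ℂ => if q.2.2.2 then z.im else z.re) ((fundamentalRep (Fin 2) (V q.1) : Matrix (Fin 2) (Fin 2) ℂ) q.2.1 q.2.2.1)) V) (Pi.single i 1) *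
          (fun z : ℂ => if i.2.2.2 then z.im else z.re)
            ((latticeLangevinDynamics (fundamentalLatticeRep 2) 0).drift
              (matrixConfig (fundamentalRep (Fin 2)) V) i.1 i.2.1 i.2.2.1) +
      1 / 2 * ∑ i : Edge 3 L × Fin 2 × Fin 2 × Bool, ∑ j : Edge 3 L × Fin 2 × Fin 2 × Bool,
        fderiv ℝ (fun z => fderiv ℝ (fun y : (Edge 3 L × Fin 2 × Fin 2 × Bool → ℝ) => β' * ∑ p : Plaquette 3 L, (rootedLoop (fun (ee : Edge 3 L) (i j : Fin 2) => ((y (ee, i, j, false) : ℝ) : ℂ) + ((y (ee, i, j, true) : ℝ) : ℂ) * Complex.I) (p.1, p.2.1.1) p.2.1.2 false).trace.re) z (Pi.single i 1)) ((fun (V : GaugeConfig 3 L (Matrix.specialUnitaryGroup (Fin 2) ℂ)) (q : Edge 3 L × Fin 2 × Fin 2 × Bool) => (fun z : ℂ => if q.2.2.2 then z.im else z.re) ((fundamentalRep (Fin 2) (V q.1) : Matrix (Fin 2) (Fin 2) ℂ) q.2.1 q.2.2.1)) V) (Pi.single j 1) *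
          ∑ n : Edge 3 L × NoiseIdx 2,
            (if n.1 = i.1 then (fun z : ℂ => if i.2.2.2 then z.im else z.re)
              ((latticeLangevinDynamics (fundamentalLatticeRep 2) 0).noise
                (matrixConfig (fundamentalRep (Fin 2)) V) i.1 n.2 i.2.1 i.2.2.1) else 0) *
            (if n.1 = j.1 then (fun z : ℂ => if j.2.2.2 then z.im else z.re)
              ((latticeLangevinDynamics (fundamentalLatticeRep 2) 0).noise
                (matrixConfig (fundamentalRep (Fin 2)) V) j.1 n.2 j.2.1 j.2.2.1) else 0))| ≤ 96 * |β'| * Fintype.card (Edge 3 L) :=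
    wilson_generator_zero_psiHat_abs_le L β' V
  have hΓ : 0 ≤ ∑ i : Edge 3 L × Fin 2 × Fin 2 × Bool, ∑ j : Edge 3 L × Fin 2 × Fin 2 × Bool,
        fderiv ℝ (fun y : (Edge 3 L × Fin 2 × Fin 2 × Bool → ℝ) => β' * ∑ p : Plaquette 3 L, (rootedLoop (fun (ee : Edge 3 L) (i j : Fin 2) => ((y (ee, i, j, false) : ℝ) : ℂ) + ((y (ee, i, j, true) : ℝ) : ℂ) * Complex.I) (p.1, p.2.1.1) p.2.1.2 false).trace.re) ((fun (V : GaugeConfig 3 L (Matrix.specialUnitaryGroup (Fin 2) ℂ)) (q : Edge 3 L × Fin 2 × Fin 2 × Bool) => (fun z : ℂ => if q.2.2.2 then z.im else z.re) ((fundamentalRep (Fin 2) (V q.1) : Matrix (Fin 2) (Fin 2) ℂ) q.2.1 q.2.2.1)) V) (Pi.single i 1) * fderiv ℝ (fun y : (Edge 3 L × Fin 2 × Fin 2 × Bool → ℝ) => β' * ∑ p : Plaquette 3 L, (rootedLoop (fun (ee : Edge 3 L) (i j : Fin 2) => ((y (ee, i, j, false) : ℝ) : ℂ) + ((y (ee,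 i, j, true) : ℝ) : ℂ) * Complex.I) (p.1, p.2.1.1) p.2.1.2 false).trace.re) ((fun (V : GaugeConfig 3 L (Matrix.specialUnitaryGroup (Fin 2) ℂ)) (q : Edge 3 L × Fin 2 × Fin 2 × Bool) => (fun z : ℂ => if q.2.2.2 then z.im else z.re) ((fundamentalRep (Fin 2) (V q.1) : Matrix (Fin 2) (Fin 2) ℂ) q.2.1 q.2.2.1)) V) (Pi.single j 1) *
          ∑ n : Edge 3 L × NoiseIdx 2,
            (if n.1 = i.1 then (fun z : ℂ => if i.2.2.2 then z.im else z.re)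
              ((latticeLangevinDynamics (fundamentalLatticeRep 2) 0).noise
                (matrixConfig (fundamentalRep (Fin 2)) V) i.1 n.2 i.2.1 i.2.2.1) else 0) *
            (if n.1 = j.1 then (fun z : ℂ => if j.2.2.2 then z.im else z.re)
              ((latticeLangevinDynamics (fundamentalLatticeRep 2) 0).noise
                (matrixConfig (fundamentalRep (Fin 2)) V) j.1 n.2 j.2.1 j.2.2.1) else 0) := by
    rw [sum_sum_mul_mul_noiseCov_eq_sum_sq]
    positivity
  have h1 := (abs_le.1 hgen).1
  linarith

/-- **The plaquette function is `O(#𝒫)`**: `|ψ̂_b(coords V)| ≤ 2|b|·#𝒫` (`ψ̂_b(coords V) = 2b#𝒫 − b·S_W(V)`, `0 ≤ S_W ≤ 4#𝒫`). [folklore] -/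
theorem abs_psiHat_coords_le (b : ℝ) (V : (GaugeConfig 3 L (Matrix.specialUnitaryGroup (Fin 2) ℂ))) :
    |(fun y : (Edge 3 L × Fin 2 × Fin 2 × Bool → ℝ) => b * ∑ p : Plaquette 3 L, (rootedLoop (fun (ee : Edge 3 L) (i j : Fin 2) => ((y (ee, i, j, false) : ℝ) : ℂ) + ((y (ee, i, j, true) : ℝ) : ℂ) * Complex.I) (p.1, p.2.1.1) p.2.1.2 false).trace.re) ((fun (V : GaugeConfig 3 L (Matrix.specialUnitaryGroup (Fin 2) ℂ)) (q : Edge 3 L × Fin 2 × Fin 2 × Bool) => (fun z : ℂ => if q.2.2.2 then z.im else z.re) ((fundamentalRep (Fin 2) (V q.1) : Matrix (Fin 2) (Fin 2) ℂ) q.2.1 q.2.2.1)) V)| ≤ 2 * |b| * Fintype.card (Plaquette 3 L) := by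
  have h : -b * wilsonAction (fundamentalRep (Fin 2)) V = (fun y : (Edge 3 L × Fin 2 × Fin 2 × Bool → ℝ) => b * ∑ p : Plaquette 3 L, (rootedLoop (fun (ee : Edge 3 L) (i j : Fin 2) => ((y (ee, i, j, false) : ℝ) : ℂ) + ((y (ee, i, j, true) : ℝ) : ℂ) * Complex.I) (p.1, p.2.1.1) p.2.1.2 false).trace.re) ((fun (V : GaugeConfig 3 L (Matrix.specialUnitaryGroup (Fin 2) ℂ)) (q : Edge 3 L × Fin 2 × Fin 2 × Bool) => (fun z : ℂ => if q.2.2.2 then z.im else z.re) ((fundamentalRep (Fin 2) (V q.1) : Matrix (Fin 2) (Fin 2) ℂ) q.2.1 q.2.2.1)) V) - 2 * b * Fintype.card (Plaquette 3 L) :=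
    neg_mul_wilsonAction_eq_psiHat b V
  have h' : (fun y : (Edge 3 L × Fin 2 × Fin 2 × Bool → ℝ) => b * ∑ p : Plaquette 3 L, (rootedLoop (fun (ee : Edge 3 L) (i j : Fin 2) => ((y (ee, i, j, false) : ℝ) : ℂ) + ((y (ee, i, j, true) : ℝ) : ℂ) * Complex.I) (p.1, p.2.1.1) p.2.1.2 false).trace.re) ((fun (V : GaugeConfig 3 L (Matrix.specialUnitaryGroup (Fin 2) ℂ)) (q : Edge 3 L × Fin 2 × Fin 2 × Bool) => (fun z : ℂ => if q.2.2.2 then z.im else z.re) ((fundamentalRep (Fin 2) (V q.1) : Matrix (Fin 2) (Fin 2) ℂ) q.2.1 q.2.2.1)) V) = 2 * b * Fintype.card (Plaquette 3 L) - b * wilsonAction (fundamentalRep (Fin 2)) V := by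
    linarith
  rw [h']
  have h0 := wilsonAction_su2_nonneg (L := L) V
  have h4 := wilsonAction_su2_le (L := L) V
  have hP : (0 : ℝ) ≤ Fintype.card (Plaquette 3 L) := Nat.cast_nonneg _
  rw [abs_le]
  constructor
  · rcases le_or_gt 0 b with hb | hb
    · rw [abs_of_nonneg hb]; nlinarith
    · rw [abs_of_neg hb]; nlinarith
  · rcases le_or_gt 0 b with hb | hb
    · rw [abs_of_nonneg hb]; nlinarith
    · rw [abs_of_neg hb]; nlinarith

end Summit.QuantumFields.YangMills.Theorems.ColdStartUniversality
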